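import Summits.CriticalPhenomena.PercolationContinuityZ3.Theorems.Transplant.FKDoubleFanCrossFarOneSided
import Summits.CriticalPhenomena.PercolationContinuityZ3.Theorems.Transplant.FKDoubleFanOneSided
import HarnessLib

/-!
# Double fans `K₂ ∨ P_{m+1}`, far cross-apex pairs whose middle is an `a`-FAN FOLLOWED BY a `b`-FAN ("MULTIFAN₁"):
# the reduction to a four-leg inequality on `InKE⁴`

Helper file (`--supports stmt-CriticalPhenomena-4575`), FK sub-lane `prim-bschramm-fk-3` (gen 34); builds on p205010 (kernel theorem, internal
audit signed; external expert review pending).  Pure real algebra plus one measure-level corollary; no sorries; standard axioms.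
Memo `bschramm/prim-bschramm-fk-3/FAR-CROSS-IX.md` §5.

`…DoubleFanOneSided` settled the middles carrying spokes of ONE apex only (the middle word is `fanCombo q F` for the `InKE` fan vector `F`).
The simplest genuinely two-sided middles are those in which every `a`-spoke precedes every `b`-spoke: blocks `ma` with `y_i = 0` followed by
blocks `mb` with `x_i = 0` (some index `ℓ` with `w(b c_i) = 0` for `j < i ≤ ℓ` and `w(a c_i) = 0` for `ℓ < i < k`).  Then the middle word
FACTORS: `midWord q (ma ++ mb) X = fanComboB q G (fanCombo q F X)` with `F` the fan vector of the `a`-fan and `G` the fan vector of the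
`b`-fan (**`midWord_multifan`**; `fanComboB` = the `a ↔ b` mirror of `fanCombo`, `fanVecB` its recursion, `fanVecB_inKE`), so the four
pinned partition functions are **`mfZ q F G u s σ τ = val_q(s ∗ BC_τ ∗ fanComboB G (fanCombo F (AC_σ ∗ u)))`** (**`crossFarZ_multifan`**) and
negative correlation of `(a c_j, b c_k)` for all such middles, at every distance and in every weighted double fan, follows from the single
four-leg inequality "`mfZ¹⁰mfZ⁰¹ − mfZ¹¹mfZ⁰⁰ ≥ 0` for all `F, G, u, s ∈ InKE q`" (**`negCorr_spokes_cross_far_of_multifan`**) — the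
analogue, with one more leg, of LEMMA′ (`fanPhi ≥ 0` on `InKE³`, `…OneSidedCorePos`).  Numerically the four-leg inequality holds on the whole
relaxation `F, G ∈ Valid ∧ U` (memo §5: 0 violations in 1,909 samples incl. boundary-biased ones), so the certificate technique of
`…OneSidedProducts/…Final/…CoreCert*` applies.  In the strip-vector language of `…DoubleFanStripVector` this is the statement that the planar-monoid
product `c_b(G) ⋆ c_a(F)` of two fan vectors satisfies the quadratic-form inequality.
[cite: Grimmett2006, §3.9 eq. (3.94) (pp. 63–64)] [folklore]
-/

noncomputable section

namespace Summit.CriticalPhenomena.PercolationContinuityZ3.Theorems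

namespace FK

namespace ThreeApex

/-! ### The `b`-fan algebra -/

/-- The element `G_ac·id + G₁·P_b + G₀·detach + G_ab·(detach ∘ P_b) + G_bc·(P_b ∘ detach)` of the `b`-fan algebra applied to `X`
(`P_b X = BC_1 ∗ X`); the `a ↔ b` mirror of `fanCombo` (the `b`-fan between `c_j` and `c` is a fan of the triple `(c_j, b, c)`). [folklore] -/
def fanComboB (q : ℝ) (G X : V5) : V5 :=
  ⟨G.zac * X.z0 + G.z1 * (conv (edgeBC 1) X).z0 + G.z0 * (detach q X).z0 + G.zab * (detach q (conv (edgeBC 1) X)).z0 +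
      G.zbc * (conv (edgeBC 1) (detach q X)).z0,
    G.zac * X.zab + G.z1 * (conv (edgeBC 1) X).zab + G.z0 * (detach q X).zab + G.zab * (detach q (conv (edgeBC 1) X)).zab +
      G.zbc * (conv (edgeBC 1) (detach q X)).zab,
    G.zac * X.zac + G.z1 * (conv (edgeBC 1) X).zac + G.z0 * (detach q X).zac + G.zab * (detach q (conv (edgeBC 1) X)).zac +
      G.zbc * (conv (edgeBC 1) (detach q X)).zac,
    G.zac * X.zbc + G.z1 * (conv (edgeBC 1) X).zbc + G.z0 * (detach q X).zbc + G.zab * (detach q (conv (edgeBC 1) X)).zbc +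
      G.zbc * (conv (edgeBC 1) (detach q X)).zbc,
    G.zac * X.z1 + G.z1 * (conv (edgeBC 1) X).z1 + G.z0 * (detach q X).z1 + G.zab * (detach q (conv (edgeBC 1) X)).z1 +
      G.zbc * (conv (edgeBC 1) (detach q X)).z1⟩

/-- With the initial fan vector the `b`-combination is the identity. [folklore] -/
theorem fanComboB_init (q : ℝ) (X : V5) : fanComboB q fanInit X = X := by
  rw [fanInit_eq]; ext <;> simp [fanComboB]

/-- **Rim step**: `E_r (fanComboB G X) = fanComboB (E_r G) X`. [folklore] -/
theorem rimStep_fanComboB (q r : ℝ) (G X : V5) : rimStep q r (fanComboB q G X) = fanComboB q (rimStep q r G) X := by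
  ext <;> simp only [rimStep, fanComboB, conv, edgeBC, detach, V5.total] <;> ring

/-- **`b`-spoke**: `BC_y ∗ (fanComboB G X) = fanComboB (BC_y ∗ G) X` (uses `P_b² = P_b`, `P_b detach P_b = P_b`). [folklore] -/
theorem conv_edgeBC_fanComboB (q y : ℝ) (G X : V5) : conv (edgeBC y) (fanComboB q G X) = fanComboB q (conv (edgeBC y) G) X := by
  ext <;> simp only [fanComboB, conv, edgeBC, detach, V5.total] <;> ring

/-- **The fan vector of a `b`-only middle**: each block `(r, x, y)` acts by the rim step `r` and then the letter `BC_y` (the `x`-entry is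
ignored; it is `0` for `b`-only middles). [folklore] -/
def fanVecB (q : ℝ) : List (ℝ × ℝ × ℝ) → V5 → V5
  | [], G => G
  | blk :: rest, G => fanVecB q rest (conv (edgeBC blk.2.2) (rimStep q blk.1 G))

/-- The `b`-fan vector is a genuine `InKE` vector for every starting vector in `InKE q`. [folklore] -/
theorem fanVecB_inKE {q : ℝ} : ∀ {l : List (ℝ × ℝ × ℝ)}, UnitBlocks l → ∀ {G : V5}, InKE q G → InKE q (fanVecB q l G) := by
  intro l
  induction l with
  | nil => intro _ G hG; simpa [fanVecB] using hG
  | cons blk rest ih =>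
    intro hl G hG
    have hb := hl blk (by simp)
    have hrest : UnitBlocks rest := fun b hb' => hl b (by simp [hb'])
    simp only [fanVecB]
    exact ih hrest (InKE.step (IsLetter.bc hb.2.2.2.2.1 hb.2.2.2.2.2) (InKE.rim hb.1 hb.2.1 hG))

/-- **`b`-only middles through the `b`-fan vector**: `midWord q mids (fanComboB G X) = fanComboB (fanVecB q mids G) X` when every `x_i = 0`. [folklore] -/
theorem midWord_oneSidedB (q : ℝ) :
    ∀ {mids : List (ℝ × ℝ × ℝ)}, (∀ blk ∈ mids, blk.2.1 = 0) → ∀ G X : V5, midWord q mids (fanComboB q G X) = fanComboB q (fanVecB q mids G) X := by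
  intro mids
  induction mids with
  | nil => intro _ G X; simp [midWord, fanVecB]
  | cons blk rest ih =>
    intro hm G X
    have hb : blk.2.1 = 0 := hm blk (by simp)
    have hrest : ∀ b ∈ rest, b.2.1 = 0 := fun b hb' => hm b (by simp [hb'])
    simp only [midWord, fanVecB, hb, conv_edgeAC_zero, rimStep_fanComboB, conv_edgeBC_fanComboB]
    exact ih hrest _ X

/-- Middle words of concatenated block lists compose. [folklore] -/
theorem midWord_appendList (q : ℝ) : ∀ (l₁ l₂ : List (ℝ × ℝ × ℝ)) (X : V5), midWord q (l₁ ++ l₂) X = midWord q l₂ (midWord q l₁ X) := by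
  intro l₁
  induction l₁ with
  | nil => intro l₂ X; rfl
  | cons blk rest ih => intro l₂ X; exact ih l₂ _

/-- **MULTIFAN₁ middles factor**: an `a`-only list `ma` followed by a `b`-only list `mb` acts as `fanComboB (G) ∘ fanCombo (F)` with the two fan
vectors `F = fanVec q ma fanInit`, `G = fanVecB q mb fanInit`. [folklore] -/
theorem midWord_multifan (q : ℝ) {ma mb : List (ℝ × ℝ × ℝ)} (ha : ∀ blk ∈ ma, blk.2.2 = 0) (hb : ∀ blk ∈ mb, blk.2.1 = 0) (X : V5) :
    midWord q (ma ++ mb) X = fanComboB q (fanVecB q mb fanInit) (fanCombo q (fanVec q ma fanInit) X) := by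
  rw [midWord_appendList, midWord_oneSided_init q ha X, ← midWord_oneSidedB q hb fanInit, fanComboB_init]

/-! ### The four pinned partition functions of a MULTIFAN₁ middle -/

/-- **The four-leg valuation**: `mfZ q F G u s σ τ = val_q(s ∗ BC_τ ∗ fanComboB G (fanCombo F (AC_σ ∗ u)))`. [folklore] -/
def mfZ (q : ℝ) (F G u s : V5) (σ τ : ℝ) : ℝ :=
  val q (conv s (conv (edgeBC τ) (fanComboB q G (fanCombo q F (conv (edgeAC σ) u)))))

/-- **`crossFarZ` of a MULTIFAN₁ middle** is the four-leg valuation at the `a`-fan vector and the `b`-fan vector (last rim step included in `G`). [folklore] -/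
theorem crossFarZ_multifan (q : ℝ) {ma mb : List (ℝ × ℝ × ℝ)} (ha : ∀ blk ∈ ma, blk.2.2 = 0) (hb : ∀ blk ∈ mb, blk.2.1 = 0)
    (rd : ℝ) (u s : V5) (σ τ : ℝ) :
    crossFarZ q (ma ++ mb) rd u s σ τ = mfZ q (fanVec q ma fanInit) (rimStep q rd (fanVecB q mb fanInit)) u s σ τ := by
  simp only [crossFarZ, mfZ, midWord_multifan q ha hb, rimStep_fanComboB]

open MeasureTheory Literature.Probability.LatticeModels Literature.Probability.Percolation
open scoped Classical

variable {V : Type*} [Fintype V]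

omit [Fintype V] in
/-- The block list splits at any intermediate index: blocks `j+1…j+ℓ+n` = blocks `j+1…j+ℓ` followed by blocks `(j+ℓ)+1…(j+ℓ)+n`. [folklore] -/
theorem midBlocks_split (w : Sym2 V → unitInterval) (a b : V) (c : ℕ → V) (j ℓ : ℕ) :
    ∀ n, midBlocks w a b c j (ℓ + n) = midBlocks w a b c j ℓ ++ midBlocks w a b c (j + ℓ) n
  | 0 => by simp [midBlocks]
  | n + 1 => by
    rw [Nat.add_succ, midBlocks, midBlocks, midBlocks_split w a b c j ℓ n, List.append_assoc]
    simp only [Nat.add_assoc]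

omit [Fintype V] in
/-- One-sided weights give one-sided blocks (`a`-version): if `w(a c_i) = 0` for `j < i ≤ j + d`, every block of `midBlocks w a b c j d` has
`x`-entry `0`. [folklore] -/
theorem midBlocks_aSpoke_zero (w : Sym2 V → unitInterval) (a b : V) (c : ℕ → V) (j : ℕ) :
    ∀ d, (∀ i, j < i → i ≤ j + d → w s(a, c i) = 0) → ∀ blk ∈ midBlocks w a b c j d, blk.2.1 = 0
  | 0 => by intro _ blk h; simp [midBlocks] at h
  | d + 1 => by
    intro hw blk h
    rw [midBlocks, List.mem_append, List.mem_singleton] at h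
    rcases h with h | rfl
    · exact midBlocks_aSpoke_zero w a b c j d (fun i hi hi' => hw i hi (by omega)) blk h
    · have h0 := hw (j + d + 1) (by omega) (by omega)
      simp [wR, h0]

section Setting

variable {a b : V} {c : ℕ → V} {m : ℕ}
variable (hab : a ≠ b) (hinj : ∀ j k, j ≤ m → k ≤ m → c j = c k → j = k) (hca : ∀ j, j ≤ m → c j ≠ a) (hcb : ∀ j, j ≤ m → c j ≠ b)
include hab hinj hca hcb

/-- **REDUCTION OF MULTIFAN₁ TO THE FOUR-LEG INEQUALITY.**  If `mfZ¹⁰·mfZ⁰¹ − mfZ¹¹·mfZ⁰⁰ ≥ 0` for all `F, G, u, s ∈ InKE q`, then for every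
weighted double fan (`card V = m + 3`, weights supported on the double-fan pairs) and all `j ≤ ℓ < k ≤ m` with `w(b c_i) = 0` for `j < i ≤ ℓ`
and `w(a c_i) = 0` for `ℓ < i < k` (all middle `a`-spokes before all middle `b`-spokes), the pair `(a c_j, b c_k)` is negatively correlated. [folklore] -/
theorem negCorr_spokes_cross_far_of_multifan (hcard : Fintype.card V = m + 3) {q : ℝ} (hq0 : 0 < q) (w : Sym2 V → unitInterval)
    (hsupp : ∀ e, e ∉ dfPairs a b c m → w e = 0)
    (hlem : ∀ F G u s : V5, InKE q F → InKE q G → InKE q u → InKE q s →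
      0 ≤ mfZ q F G u s 1 0 * mfZ q F G u s 0 1 - mfZ q F G u s 1 1 * mfZ q F G u s 0 0)
    {j ℓ k : ℕ} (hjl : j ≤ ℓ) (hlk : ℓ < k) (hk : k ≤ m) (hb0 : ∀ i, j < i → i ≤ ℓ → w s(b, c i) = 0)
    (ha0 : ∀ i, ℓ < i → i < k → w s(a, c i) = 0) :
    (rcMeasureW w q ∅).real ({ω : BondConfig V | s(a, c j) ∈ ω} ∩ {ω | s(b, c k) ∈ ω}) ≤
      (rcMeasureW w q ∅).real {ω : BondConfig V | s(a, c j) ∈ ω} * (rcMeasureW w q ∅).real {ω : BondConfig V | s(b, c k) ∈ ω} := by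
  obtain ⟨d, rfl⟩ : ∃ d, k = j + d + 1 := ⟨k - j - 1, by omega⟩
  refine negCorr_spokes_cross_far_of_rayleigh hab hinj hca hcb hcard hq0 w hsupp hk ?_
  have huK : InKE q (conv (edgeBC (wR w s(b, c j))) (blockIn q w a b c j)) :=
    InKE.step (IsLetter.bc (w _).2.1 (w _).2.2) (inKE_blockIn q w a b c j)
  have hsK : InKE q (conv (restVec q w a b c (j + d + 1) (m - (j + d + 1))) (edgeAC (wR w s(a, c (j + d + 1))))) :=
    InKE.mul (inKE_restVec q w a b c (m - (j + d + 1)) (j + d + 1)) (by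
      rw [← mul_one (edgeAC (wR w s(a, c (j + d + 1)))), mul_def, one_def]
      exact InKE.step (IsLetter.ac (w _).2.1 (w _).2.2) InKE.base)
  obtain ⟨n, hn⟩ : ∃ n, d = (ℓ - j) + n := ⟨d - (ℓ - j), by omega⟩
  have hsplit : midBlocks w a b c j d = midBlocks w a b c j (ℓ - j) ++ midBlocks w a b c (j + (ℓ - j)) n := by
    rw [hn]; exact midBlocks_split w a b c j (ℓ - j) n
  have hya : ∀ blk ∈ midBlocks w a b c j (ℓ - j), blk.2.2 = 0 :=
    midBlocks_bSpoke_zero w a b c j (ℓ - j) (fun i hi hi' => hb0 i hi (by omega))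
  have hxb : ∀ blk ∈ midBlocks w a b c (j + (ℓ - j)) n, blk.2.1 = 0 :=
    midBlocks_aSpoke_zero w a b c (j + (ℓ - j)) n (fun i hi hi' => ha0 i (by omega) (by omega))
  have hF : InKE q (fanVec q (midBlocks w a b c j (ℓ - j)) fanInit) :=
    fanVec_inKE (unitBlocks_midBlocks w a b c j (ℓ - j)) (fanInit_inKE q)
  have hG : InKE q (rimStep q (wR w s(c (j + d), c (j + d + 1))) (fanVecB q (midBlocks w a b c (j + (ℓ - j)) n) fanInit)) :=
    InKE.rim (w _).2.1 (w _).2.2 (fanVecB_inKE (unitBlocks_midBlocks w a b c (j + (ℓ - j)) n) (fanInit_inKE q))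
  have key := hlem _ _ _ _ hF hG huK hsK
  simp only
  rw [hsplit, crossFarZ_multifan q hya hxb, crossFarZ_multifan q hya hxb, crossFarZ_multifan q hya hxb, crossFarZ_multifan q hya hxb]
  linarith [key]

end Setting

end ThreeApex

end FK

end Summit.CriticalPhenomena.PercolationContinuityZ3.Theorems
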